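import Mathlib
import HarnessLib

/-!
# Route `PoloidalWindowDoor`, item `LrcModEntire` (stmt-NavierStokesRegularity-20428), cell (Q4-sonic, straight branch, μ(−1,0) < 0), case I —
# THE FREQUENCY OF THE SHEET DATA DOES NOT MOVE IN TIME (brick B-FREQ of T2B-g17 v2 §5(5d))

Cell ns-regularity-ideate, LEAD-lineage seat ns-poloidal-K2-p3 g17 (`--supports stmt-NavierStokesRegularity-20428`).  Class-free.

In case I of `stub_Q4sonicLineNeg` the horizontal velocity on the web sheet at time `−1+τ` is a degree-one trigonometric polynomial
`f(τ;s) = c₀(τ) + c₁(τ)cos(ω(τ)s) + c₂(τ)sin(ω(τ)s)` (T2B-g17 §5(5c)); its τ-derivative is `c₀′ + c₁′cos(ωs) + c₂′sin(ωs) + ω′·s·(−c₁sin(ωs) + c₂cos(ωs))` and is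
BOUNDED in `s` (class derivative bounds).  The secular factor `s` forces `ω′·c₁ = ω′·c₂ = 0`: the frequency is locked wherever the oscillation is present.

* `eq_zero_of_mul_trig_bounded` — `ω ≠ 0` and `s ↦ s·(a·sin(ωs) + b·cos(ωs))` bounded on ℝ ⇒ `a = 0 ∧ b = 0` (evaluate at `s = 2πn/ω` and `s = (π/2 + 2πn)/ω`);
* `frequency_locked` — the applied form: `s ↦ p₀ + p₁cos(ωs) + p₂sin(ωs) + ω′·s·(−c₁sin(ωs) + c₂cos(ωs))` bounded, `ω ≠ 0` ⇒ `ω′·c₁ = 0 ∧ ω′·c₂ = 0`.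

WHAT THIS IS NOT: not a claim about Navier–Stokes regularity and not a stub of the registry; an elementary lemma for the residual research cell `stub_Q4sonicLineNeg`
of `Cruxes/LrcModEntire/Lines/twist_split.lean` v12 (bears_on LADDER-NS N0 via item 20428).
-/

noncomputable section

set_option linter.dupNamespace false

namespace Summit.NavierStokesRegularity.NavierStokesRegularity.Theorems.PoloidalWindowDoorLrcModEntireFrequencyLock

open Set Filter Topology

/-- A real number whose products with all naturals are bounded in absolute value is zero. -/
theorem eq_zero_of_nat_mul_bounded {x M : ℝ} (h : ∀ n : ℕ, |(n : ℝ) * x| ≤ M) : x = 0 := by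
  by_contra hx
  have hxpos : 0 < |x| := abs_pos.2 hx
  obtain ⟨n, hn⟩ := exists_nat_gt (M / |x|)
  have h1 := h n
  rw [abs_mul, Nat.abs_cast] at h1
  have h2 : M < (n : ℝ) * |x| := by rwa [div_lt_iff₀ hxpos] at hn
  linarith

/-- **The secular term kills the amplitudes**: if `ω ≠ 0` and `s ↦ s·(a·sin(ωs) + b·cos(ωs))` is bounded on ℝ then `a = b = 0`. -/
theorem eq_zero_of_mul_trig_bounded {ω a b M : ℝ} (hω : ω ≠ 0)
    (h : ∀ s : ℝ, |s * (a * Real.sin (ω * s) + b * Real.cos (ω * s))| ≤ M) : a = 0 ∧ b = 0 := by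
  have hpi : (0 : ℝ) < 2 * Real.pi := by positivity
  -- `b = 0`: evaluate at `s = 2πn/ω`
  have hb : b = 0 := by
    have key : ∀ n : ℕ, |(n : ℝ) * (2 * Real.pi / ω * b)| ≤ M := by
      intro n
      have hs := h ((n : ℝ) * (2 * Real.pi) / ω)
      have e1 : ω * ((n : ℝ) * (2 * Real.pi) / ω) = (n : ℝ) * (2 * Real.pi) := by field_simp
      have hsin0 : Real.sin ((n : ℝ) * (2 * Real.pi)) = 0 := by simpa using Real.sin_add_nat_mul_two_pi 0 n
      rw [e1, hsin0, Real.cos_nat_mul_two_pi, mul_zero, zero_add, mul_one] at hs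
      have e2 : (n : ℝ) * (2 * Real.pi) / ω * b = (n : ℝ) * (2 * Real.pi / ω * b) := by ring
      rwa [e2] at hs
    have := eq_zero_of_nat_mul_bounded key
    rcases mul_eq_zero.1 this with h1 | h1
    · exfalso
      rcases div_eq_zero_iff.1 h1 with h2 | h2
      · linarith
      · exact hω h2
    · exact h1
  -- `a = 0`: evaluate at `s = (π/2 + 2πn)/ω`
  have ha : a = 0 := by
    have key : ∀ n : ℕ, |(n : ℝ) * (2 * Real.pi / ω * a)| ≤ M + |Real.pi / 2 / ω * a| := by
      intro n
      have hs := h ((Real.pi / 2 + (n : ℝ) * (2 * Real.pi)) / ω)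
      have e1 : ω * ((Real.pi / 2 + (n : ℝ) * (2 * Real.pi)) / ω) = Real.pi / 2 + (n : ℝ) * (2 * Real.pi) := by field_simp
      rw [e1, Real.sin_add_nat_mul_two_pi, Real.cos_add_nat_mul_two_pi, Real.sin_pi_div_two, Real.cos_pi_div_two,
        mul_one, mul_zero, add_zero] at hs
      have e2 : (Real.pi / 2 + (n : ℝ) * (2 * Real.pi)) / ω * a = Real.pi / 2 / ω * a + (n : ℝ) * (2 * Real.pi / ω * a) := by
        ring
      rw [e2] at hs
      have tri : |(n : ℝ) * (2 * Real.pi / ω * a)| ≤ |Real.pi / 2 / ω * a + (n : ℝ) * (2 * Real.pi / ω * a)| + |Real.pi / 2 / ω * a| := by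
        have := abs_sub_abs_le_abs_sub ((n : ℝ) * (2 * Real.pi / ω * a)) (-(Real.pi / 2 / ω * a))
        rw [abs_neg, sub_neg_eq_add, add_comm ((n : ℝ) * (2 * Real.pi / ω * a))] at this
        linarith
      linarith
    have := eq_zero_of_nat_mul_bounded key
    rcases mul_eq_zero.1 this with h1 | h1
    · exfalso
      rcases div_eq_zero_iff.1 h1 with h2 | h2
      · linarith
      · exact hω h2
    · exact h1
  exact ⟨ha, hb⟩

/-- **Frequency locking** (T2B-g17 §5(5d)): if `ω ≠ 0` and the τ-derivative of a degree-one trigonometric family,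
`s ↦ p₀ + p₁cos(ωs) + p₂sin(ωs) + ω′·s·(−c₁sin(ωs) + c₂cos(ωs))`, is bounded on ℝ, then `ω′·c₁ = 0` and `ω′·c₂ = 0`. -/
theorem frequency_locked {ω ω' p₀ p₁ p₂ c₁ c₂ M : ℝ} (hω : ω ≠ 0)
    (h : ∀ s : ℝ, |p₀ + p₁ * Real.cos (ω * s) + p₂ * Real.sin (ω * s) + ω' * s * (-c₁ * Real.sin (ω * s) + c₂ * Real.cos (ω * s))| ≤ M) :
    ω' * c₁ = 0 ∧ ω' * c₂ = 0 := by
  -- the trigonometric part is bounded by `|p₀| + |p₁| + |p₂|`, so the secular part is bounded too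
  have hsec : ∀ s : ℝ, |s * ((-(ω' * c₁)) * Real.sin (ω * s) + (ω' * c₂) * Real.cos (ω * s))| ≤ M + (|p₀| + |p₁| + |p₂|) := by
    intro s
    have h1 := h s
    have hc : |p₁ * Real.cos (ω * s)| ≤ |p₁| := by
      rw [abs_mul]; exact mul_le_of_le_one_right (abs_nonneg _) (Real.abs_cos_le_one _)
    have hsn : |p₂ * Real.sin (ω * s)| ≤ |p₂| := by
      rw [abs_mul]; exact mul_le_of_le_one_right (abs_nonneg _) (Real.abs_sin_le_one _)
    have e : s * ((-(ω' * c₁)) * Real.sin (ω * s) + (ω' * c₂) * Real.cos (ω * s)) =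
        (p₀ + p₁ * Real.cos (ω * s) + p₂ * Real.sin (ω * s) + ω' * s * (-c₁ * Real.sin (ω * s) + c₂ * Real.cos (ω * s))) -
          (p₀ + p₁ * Real.cos (ω * s) + p₂ * Real.sin (ω * s)) := by ring
    rw [e]
    have tri := abs_sub (p₀ + p₁ * Real.cos (ω * s) + p₂ * Real.sin (ω * s) + ω' * s * (-c₁ * Real.sin (ω * s) + c₂ * Real.cos (ω * s)))
      (p₀ + p₁ * Real.cos (ω * s) + p₂ * Real.sin (ω * s))
    have tri2 : |p₀ + p₁ * Real.cos (ω * s) + p₂ * Real.sin (ω * s)| ≤ |p₀| + |p₁| + |p₂| := by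
      have := abs_add_le (p₀ + p₁ * Real.cos (ω * s)) (p₂ * Real.sin (ω * s))
      have := abs_add_le p₀ (p₁ * Real.cos (ω * s))
      linarith
    linarith
  obtain ⟨h1, h2⟩ := eq_zero_of_mul_trig_bounded hω hsec
  constructor
  · linarith
  · exact h2

end Summit.NavierStokesRegularity.NavierStokesRegularity.Theorems.PoloidalWindowDoorLrcModEntireFrequencyLock

end
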